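import Summits.CriticalPhenomena.CardyFormulaZ2.Theorems.CardyMagicRigidityPinchResamplingDefsV4
import Summits.CriticalPhenomena.CardyFormulaZ2.Theorems.CardyMagicRigidityNestingRigidityNeckCoarseStructure
import Literature.Probability.Percolation.AnnulusAlternation
import Literature.Probability.Percolation.ArmSeparationFourArm
import Literature.Probability.Percolation.KestenScaling
import Literature.Probability.Percolation.TriCrossingChains
import HarnessLib

/-!
# The cluster-form four-arm event of stub S11 on site `𝕋`: dictionary with the tree's arm event

Crux `Summit.CriticalPhenomena.CardyFormulaZ2.Theses.CardyMagicRigidity.NestingRigidity` (stmt-CriticalPhenomena-4835),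
line `pinch-resampling` v4, stub S11 `stub_neckHookupCoarseT`.  The covering lemmas `covering_A_nodes` / `covering_B_nodes`
(`…NeckCoveringA/B`) reduce the approximation error of the fuzzy hook-up to honest CLUSTER-FORM four-arm events around
inner-layer sites: two open crossings of a hexagonal annulus `{r ≤ |· - z|_𝕋 ≤ R}` lying in distinct open clusters of the
annulus.  This file fixes that event (`TFourArmTwoClusters`), the shapes (I4T) `FourArmTwoClustersBoundT` of the two-radius
bound with exponent `> 1` and (I0) `TPinchPositive` that the summation consumes, and proves the DICTIONARY with the tree's order-free arm event:

* `TFourArmTwoClusters z r R ⊆` translate by `z` of `armEvent ![T,F,T,F] r R` (`1 ≤ r`, `r + 2 ≤ R`): the two closed arms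
  are the frontier chains of `Literature.Probability.Percolation.exists_frontierChains_alternating` (Kesten 1982 §2.3 made
  combinatorial in `AnnulusAlternation.lean`), assembled by `mem_armEvent_four_of_disjointPaths`;
* translation invariance of `P_{1/2}` (`sitePercolation_real_preimage_relabel`), whence
  `real_tFourArmTwoClusters_le_critFourArmProb : P_{1/2}(TFourArmTwoClusters z r R) ≤ critFourArmProb r R`;
* `fourArmTwoClustersBoundT_of_critFourArmProb_le`: (I4T) follows from ANY two-radius bound
  `critFourArmProb r R ≤ C (r/R)^{1+ε}` (`1 ≤ r ≤ R`) on the tree's critical four-arm probability.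

No named fact is introduced; the two-radius bound on `critFourArmProb` itself is NOT in the tree (see
`…NeckFourArmBoundT` for its derivation from the named fact `SmirnovWerner2001_fourArm_scalingLimit`).
-/

noncomputable section

namespace Summit.CriticalPhenomena.CardyFormulaZ2.Cruxes.NestingRigidity.PinchResampling

open MeasureTheory Set Literature.Probability.Percolation Literature.Probability.LatticeModels

/-! ### The event and its elementary API -/

/-- **Cluster form of four alternating arms around `z` from radius `r` to radius `R` (site `𝕋`)**: two open crossings of
the hexagonal annulus `{r ≤ |· - z|_𝕋 ≤ R}`, from its inner sphere to its outer sphere and inside it, that are NOT joined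
by an open path of the annulus (two distinct open clusters of the annulus cross it; the two separating closed crossings
are then automatic, `tFourArmTwoClusters_zero_subset_armEvent`).  This is literally the conclusion of the covering lemmas
`covering_A_nodes` / `covering_B_nodes`. -/
def TFourArmTwoClusters (z : Site 2) (r R : ℕ) : Set (SiteConfig (Site 2)) :=
  {ω | ∃ p₁ q₁ p₂ q₂ : Site 2, triNorm (p₁ - z) = r ∧ triNorm (q₁ - z) = R ∧ triNorm (p₂ - z) = r ∧ triNorm (q₂ - z) = R ∧
    PathIn (tColourGraph ω true) {y | (r : ℤ) ≤ triNorm (y - z) ∧ triNorm (y - z) ≤ R} p₁ q₁ ∧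
    PathIn (tColourGraph ω true) {y | (r : ℤ) ≤ triNorm (y - z) ∧ triNorm (y - z) ≤ R} p₂ q₂ ∧
    ¬ PathIn (tColourGraph ω true) {y | (r : ℤ) ≤ triNorm (y - z) ∧ triNorm (y - z) ≤ R} p₁ p₂}

/-- **(I4T) Two-radius four-arm bound with exponent strictly larger than one, cluster form, critical site percolation on
`𝕋`.**  There are `ε > 0` and `C` such that for all centres `z` and radii `1 ≤ r ≤ R`,
`P_{1/2}(TFourArmTwoClusters z r R) ≤ C (r/R)^{1+ε}`.  NOT in the tree; reduced below to the same bound for the tree's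
`critFourArmProb` (`fourArmTwoClustersBoundT_of_critFourArmProb_le`). -/
def FourArmTwoClustersBoundT : Prop :=
  ∃ ε C : ℝ, 0 < ε ∧ ∀ (z : Site 2) (r R : ℕ), 1 ≤ r → r ≤ R →
    (triSitePercolation half).real (TFourArmTwoClusters z r R) ≤ C * ((r : ℝ) / R) ^ (1 + ε)

/-- **(I0) Positivity of the selection event at ratio `2` (RSW).**  There are `s₀` and `c₀ > 0` such that for all centres
`x` and all `s ≥ s₀`, `P_{1/2}(TPinch x x s s) ≥ c₀` — exactly two open and exactly two closed crossing clusters of the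
collar `Λ_{2s}(x) ∖ Λ_s(x)`.  (Russo–Seymour–Welsh on `𝕋` at `p = 1/2` by a finite pattern of parallelogram crossings of
fixed aspect ratio in four sectors; the "exactly" requires transversal blocking paths.  NOT in the tree: the second input of
the S11 summation, which turns an absolute bound on `P(TPinch ∩ ·)` into the relative bound of `NeckHookupCoarseT`.) -/
def TPinchPositive : Prop :=
  ∃ s₀ : ℕ, ∃ c₀ : ℝ, 0 < c₀ ∧ ∀ (x : Site 2) (s : ℕ), s₀ ≤ s → c₀ ≤ (triSitePercolation half).real (TPinch x x s s)

/-- The cluster-form four-arm event reads only the sites of its annulus. -/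
theorem determinedBy_tFourArmTwoClusters (z : Site 2) (r R : ℕ) :
    DeterminedBy (TFourArmTwoClusters z r R) {y | (r : ℤ) ≤ triNorm (y - z) ∧ triNorm (y - z) ≤ R} := by
  rw [determinedBy_iff]
  intro ω ω' h
  have hc : ∀ a b, PathIn (tColourGraph ω true) {y | (r : ℤ) ≤ triNorm (y - z) ∧ triNorm (y - z) ≤ R} a b ↔
      PathIn (tColourGraph ω' true) {y | (r : ℤ) ≤ triNorm (y - z) ∧ triNorm (y - z) ≤ R} a b :=
    pathIn_congr_of_adj_iff (tColourGraph_adj_iff_of_inter_eq h true)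
  constructor
  · rintro ⟨p₁, q₁, p₂, q₂, h1, h2, h3, h4, hp1, hp2, hn⟩
    exact ⟨p₁, q₁, p₂, q₂, h1, h2, h3, h4, (hc _ _).1 hp1, (hc _ _).1 hp2, fun h' ↦ hn ((hc _ _).2 h')⟩
  · rintro ⟨p₁, q₁, p₂, q₂, h1, h2, h3, h4, hp1, hp2, hn⟩
    exact ⟨p₁, q₁, p₂, q₂, h1, h2, h3, h4, (hc _ _).2 hp1, (hc _ _).2 hp2, fun h' ↦ hn ((hc _ _).1 h')⟩

/-- The annulus of the event is finite. -/
theorem finite_tAnnulus (z : Site 2) (r R : ℕ) : {y : Site 2 | (r : ℤ) ≤ triNorm (y - z) ∧ triNorm (y - z) ≤ R}.Finite := by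
  refine (tBall_finite z R).subset fun y hy ↦ ?_
  simp only [tBall, mem_setOf_eq]
  exact hy.2

/-- The cluster-form four-arm event is measurable. -/
theorem measurableSet_tFourArmTwoClusters (z : Site 2) (r R : ℕ) : MeasurableSet (TFourArmTwoClusters z r R) :=
  measurableSet_of_determinedBy_finite (finite_tAnnulus z r R) (determinedBy_tFourArmTwoClusters z r R)

/-- **Independence over disjoint annuli**: cluster-form four-arm events around two annuli with disjoint site sets are
independent under `P_{1/2}`. -/
theorem measureReal_inter_tFourArmTwoClusters {z z' : Site 2} {r R r' R' : ℕ}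
    (h : Disjoint {y : Site 2 | (r : ℤ) ≤ triNorm (y - z) ∧ triNorm (y - z) ≤ R}
      {y : Site 2 | (r' : ℤ) ≤ triNorm (y - z') ∧ triNorm (y - z') ≤ R'}) :
    (triSitePercolation half).real (TFourArmTwoClusters z r R ∩ TFourArmTwoClusters z' r' R') =
      (triSitePercolation half).real (TFourArmTwoClusters z r R) *
        (triSitePercolation half).real (TFourArmTwoClusters z' r' R') := by
  have hsub : {y : Site 2 | (r' : ℤ) ≤ triNorm (y - z') ∧ triNorm (y - z') ≤ R'} ⊆
      {y : Site 2 | (r : ℤ) ≤ triNorm (y - z) ∧ triNorm (y - z) ≤ R}ᶜ :=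
    fun y hy hy' ↦ Set.disjoint_left.1 h hy' hy
  exact measureReal_inter_of_determinedBy_compl (measurableSet_tFourArmTwoClusters z r R)
    (measurableSet_tFourArmTwoClusters z' r' R') (determinedBy_tFourArmTwoClusters z r R)
    ((determinedBy_tFourArmTwoClusters z' r' R').mono hsub)

/-! ### Open paths of a set versus `𝕋`-paths of its open sites -/

namespace NeckCoarse

/-- A path of the open graph from an open site is a `𝕋`-path of open sites. -/
theorem pathIn_inter_of_pathIn_open {ω : SiteConfig (Site 2)} {A : Set (Site 2)} {u v : Site 2}
    (h : PathIn (tColourGraph ω true) A u v) (hu : u ∈ ω) : PathIn triGraph (A ∩ ω) u v := by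
  rw [tColourGraph_true] at h
  obtain ⟨huA, h⟩ := h
  refine ⟨⟨huA, hu⟩, ?_⟩
  induction h with
  | refl => exact Relation.ReflTransGen.refl
  | tail _ hbc ih =>
    have h' := (siteOpenGraph_adj triGraph ω _ _).1 hbc.1
    exact ih.tail ⟨h'.1, hbc.2, h'.2.2⟩

/-- A `𝕋`-path of open sites is a path of the open graph. -/
theorem pathIn_open_of_pathIn_inter {ω : SiteConfig (Site 2)} {A : Set (Site 2)} {u v : Site 2}
    (h : PathIn triGraph (A ∩ ω) u v) : PathIn (tColourGraph ω true) A u v := by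
  rw [tColourGraph_true]
  obtain ⟨huA, h⟩ := h
  refine ⟨huA.1, ?_⟩
  induction h with
  | refl => exact Relation.ReflTransGen.refl
  | @tail b c hab hbc ih =>
    have hb : b ∈ ω := by
      have : PathIn triGraph (A ∩ ω) u b := ⟨huA, hab⟩
      exact this.right_mem.2
    exact ih.tail ⟨(siteOpenGraph_adj triGraph ω _ _).2 ⟨hbc.1, hb, hbc.2.2⟩, hbc.2.1⟩

end NeckCoarse

/-! ### The dictionary at the origin: two open crossings in distinct clusters give four alternating arms -/

/-- The annulus of the event centred at the origin is the tree's `triAnn`. -/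
theorem tAnnulus_zero_eq_triAnn (r R : ℕ) :
    {y : Site 2 | (r : ℤ) ≤ triNorm (y - 0) ∧ triNorm (y - 0) ≤ R} = triAnn r R := by
  ext y
  rw [mem_triAnn, mem_setOf_eq, sub_zero]

/-- **Two open crossings in distinct open clusters of `{n ≤ |·| ≤ N}` give four alternating arms** (order-free arm
event of the tree): the open arms inside the two open clusters, the closed arms inside the closed clusters of the two
frontier chains of `exists_frontierChains_alternating`, which are not joined by a closed path of the annulus. -/
theorem tFourArmTwoClusters_zero_subset_armEvent {n N : ℕ} (hn : 1 ≤ n) (hnN : n + 2 ≤ N) :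
    TFourArmTwoClusters 0 n N ⊆ armEvent ![true, false, true, false] n N := by
  rintro ω ⟨p₁, q₁, p₂, q₂, hp₁, hq₁, hp₂, hq₂, hP₁, hP₂, hsep⟩
  rw [tAnnulus_zero_eq_triAnn] at hP₁ hP₂ hsep
  rw [sub_zero] at hp₁ hq₁ hp₂ hq₂
  -- the crossings are nontrivial, hence start at open sites
  have hne : ∀ {p q : Site 2}, triNorm p = n → triNorm q = N → p ≠ q := by
    rintro p q hp hq rfl; omega
  have hp₁ω : p₁ ∈ ω := by
    rw [tColourGraph_true] at hP₁; exact NeckCoarse.mem_of_pathIn_ne hP₁ (hne hp₁ hq₁)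
  have hp₂ω : p₂ ∈ ω := by
    rw [tColourGraph_true] at hP₂; exact NeckCoarse.mem_of_pathIn_ne hP₂ (hne hp₂ hq₂)
  have hB₁ := NeckCoarse.pathIn_inter_of_pathIn_open hP₁ hp₁ω
  have hB₂ := NeckCoarse.pathIn_inter_of_pathIn_open hP₂ hp₂ω
  have hsep' : ¬ PathIn triGraph (triAnn n N ∩ ω) p₁ p₂ := fun h ↦ hsep (NeckCoarse.pathIn_open_of_pathIn_inter h)
  obtain ⟨F, hnj, -, -, -⟩ := exists_frontierChains_alternating hn hnN hB₁ hp₁ hq₁ hB₂ hp₂ hq₂ hsep'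
  -- the four zones: the open clusters of `p₁`, `p₂` and the closed clusters of the frontier chains' outer ends
  have hZ₀ω : ∀ v ∈ annCluster n N ω p₁, v ∈ triAnn n N ∧ v ∈ ω := fun v hv ↦ annCluster_subset hv
  have hZ₂ω : ∀ v ∈ annCluster n N ω p₂, v ∈ triAnn n N ∧ v ∈ ω := fun v hv ↦ annCluster_subset hv
  have hZ₁ω : ∀ v ∈ {v | PathIn triGraph (triAnn n N \ ω) F.τ₁ v}, v ∈ triAnn n N ∧ v ∉ ω :=
    fun v (hv : PathIn triGraph (triAnn n N \ ω) F.τ₁ v) ↦ hv.right_mem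
  have hZ₃ω : ∀ v ∈ {v | PathIn triGraph (triAnn n N \ ω) F.τ₂ v}, v ∈ triAnn n N ∧ v ∉ ω :=
    fun v (hv : PathIn triGraph (triAnn n N \ ω) F.τ₂ v) ↦ hv.right_mem
  have h01 : Disjoint (annCluster n N ω p₁) {v | PathIn triGraph (triAnn n N \ ω) F.τ₁ v} :=
    Set.disjoint_left.2 fun v h0 h1 ↦ (hZ₁ω v h1).2 (hZ₀ω v h0).2
  have h03 : Disjoint (annCluster n N ω p₁) {v | PathIn triGraph (triAnn n N \ ω) F.τ₂ v} :=
    Set.disjoint_left.2 fun v h0 h3 ↦ (hZ₃ω v h3).2 (hZ₀ω v h0).2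
  have h12 : Disjoint {v | PathIn triGraph (triAnn n N \ ω) F.τ₁ v} (annCluster n N ω p₂) :=
    Set.disjoint_left.2 fun v h1 h2 ↦ (hZ₁ω v h1).2 (hZ₂ω v h2).2
  have h23 : Disjoint (annCluster n N ω p₂) {v | PathIn triGraph (triAnn n N \ ω) F.τ₂ v} :=
    Set.disjoint_left.2 fun v h2 h3 ↦ (hZ₃ω v h3).2 (hZ₂ω v h2).2
  have h02 : Disjoint (annCluster n N ω p₁) (annCluster n N ω p₂) :=
    Set.disjoint_left.2 fun v (h0 : PathIn triGraph (triAnn n N ∩ ω) p₁ v) (h2 : PathIn triGraph (triAnn n N ∩ ω) p₂ v) ↦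
      hsep' (h0.trans h2.symm)
  have h13 : Disjoint {v | PathIn triGraph (triAnn n N \ ω) F.τ₁ v} {v | PathIn triGraph (triAnn n N \ ω) F.τ₂ v} :=
    Set.disjoint_left.2 fun v (h1 : PathIn triGraph (triAnn n N \ ω) F.τ₁ v) (h3 : PathIn triGraph (triAnn n N \ ω) F.τ₂ v) ↦
      hnj (h1.trans h3.symm)
  -- membership conversions
  have hopen : ∀ {Z : Set (Site 2)}, (∀ v ∈ Z, v ∈ triAnn n N ∧ v ∈ ω) →
      Z ⊆ Z ∩ triAnnSet n N ∩ {v | v ∈ ω ↔ true} := by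
    intro Z hZ v hv
    refine ⟨⟨hv, mem_triAnnSet.2 (mem_triAnn.1 (hZ v hv).1)⟩, ?_⟩
    simpa using (hZ v hv).2
  have hclosed : ∀ {Z : Set (Site 2)}, (∀ v ∈ Z, v ∈ triAnn n N ∧ v ∉ ω) →
      Z ⊆ Z ∩ triAnnSet n N ∩ {v | v ∈ ω ↔ false} := by
    intro Z hZ v hv
    refine ⟨⟨hv, mem_triAnnSet.2 (mem_triAnn.1 (hZ v hv).1)⟩, ?_⟩
    simpa using (hZ v hv).2
  refine mem_armEvent_four_of_disjointPaths h01 h02 h03 h12 h13 h23 ?_ ?_ ?_ ?_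
  · exact ⟨p₁, q₁, hp₁, hq₁, (PathIn.to_reach hB₁).mono (hopen hZ₀ω)⟩
  · refine ⟨F.σ₁, F.τ₁, F.norm_σ₁, F.norm_τ₁, ?_⟩
    have h1 : PathIn triGraph (triAnn n N \ ω) F.τ₁ F.σ₁ := (F.chain₁.mono annFrontier_subset).symm
    exact (PathIn.to_reach h1).symm.mono (hclosed hZ₁ω)
  · exact ⟨p₂, q₂, hp₂, hq₂, (PathIn.to_reach hB₂).mono (hopen hZ₂ω)⟩
  · refine ⟨F.σ₂, F.τ₂, F.norm_σ₂, F.norm_τ₂, ?_⟩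
    have h3 : PathIn triGraph (triAnn n N \ ω) F.τ₂ F.σ₂ := F.chain₂.mono annFrontier_subset
    exact (PathIn.to_reach h3).symm.mono (hclosed hZ₃ω)

/-! ### Translation to an arbitrary centre -/

namespace NeckCoarse

/-- **Transport of open annulus paths along a lattice translation**: translating the configuration, the centre and the
endpoints by `-v`. -/
theorem pathIn_open_shift (v z : Site 2) {r R : ℕ} {ω : SiteConfig (Site 2)} {a b : Site 2}
    (h : PathIn (tColourGraph ω true) {y | (r : ℤ) ≤ triNorm (y - z) ∧ triNorm (y - z) ≤ R} a b) :
    PathIn (tColourGraph (SiteConfig.relabel (triShiftIso (-v)).toEquiv ω) true)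
      {y | (r : ℤ) ≤ triNorm (y - (z - v)) ∧ triNorm (y - (z - v)) ≤ R} (a - v) (b - v) := by
  rw [tColourGraph_true] at h ⊢
  obtain ⟨ha, h⟩ := h
  refine ⟨by simpa only [mem_setOf_eq, sub_sub_sub_cancel_right] using ha, ?_⟩
  induction h with
  | refl => exact Relation.ReflTransGen.refl
  | @tail c d _ hcd ih =>
    have h' := (siteOpenGraph_adj triGraph ω _ _).1 hcd.1
    refine ih.tail ⟨(siteOpenGraph_adj triGraph _ _ _).2 ⟨?_, ?_, ?_⟩, ?_⟩
    · have := (triGraph_adj_shift_iff (-v) c d).2 h'.1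
      simpa only [Site.shift_apply, ← sub_eq_add_neg] using this
    · rw [mem_relabel_triShiftIso_neg_iff, sub_add_cancel]; exact h'.2.1
    · rw [mem_relabel_triShiftIso_neg_iff, sub_add_cancel]; exact h'.2.2
    · simpa only [mem_setOf_eq, sub_sub_sub_cancel_right] using hcd.2

/-- Translating by `-v` and back. -/
theorem relabel_shift_neg_neg (v : Site 2) (ω : SiteConfig (Site 2)) :
    SiteConfig.relabel (triShiftIso (- -v)).toEquiv (SiteConfig.relabel (triShiftIso (-v)).toEquiv ω) = ω := by
  ext y
  rw [mem_relabel_triShiftIso_neg_iff, mem_relabel_triShiftIso_neg_iff, neg_add_cancel_right]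

end NeckCoarse

/-- **Translation**: the event around `z` is the preimage of the event around the origin under the relabelling of the
configuration by `y ↦ y - z`. -/
theorem tFourArmTwoClusters_eq_preimage (z : Site 2) (r R : ℕ) :
    TFourArmTwoClusters z r R = SiteConfig.relabel (triShiftIso (-z)).toEquiv ⁻¹' TFourArmTwoClusters 0 r R := by
  ext ω
  rw [mem_preimage]
  constructor
  · rintro ⟨p₁, q₁, p₂, q₂, hp₁, hq₁, hp₂, hq₂, hP₁, hP₂, hsep⟩
    have k₁ := NeckCoarse.pathIn_open_shift z z hP₁
    have k₂ := NeckCoarse.pathIn_open_shift z z hP₂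
    rw [sub_self] at k₁ k₂
    refine ⟨p₁ - z, q₁ - z, p₂ - z, q₂ - z, by rwa [sub_zero], by rwa [sub_zero], by rwa [sub_zero],
      by rwa [sub_zero], k₁, k₂, fun h ↦ hsep ?_⟩
    have k := NeckCoarse.pathIn_open_shift (-z) 0 h
    rw [NeckCoarse.relabel_shift_neg_neg, zero_sub, neg_neg, sub_neg_eq_add, sub_neg_eq_add, sub_add_cancel,
      sub_add_cancel] at k
    exact k
  · rintro ⟨p₁, q₁, p₂, q₂, hp₁, hq₁, hp₂, hq₂, hP₁, hP₂, hsep⟩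
    have k₁ := NeckCoarse.pathIn_open_shift (-z) 0 hP₁
    have k₂ := NeckCoarse.pathIn_open_shift (-z) 0 hP₂
    rw [NeckCoarse.relabel_shift_neg_neg, zero_sub, neg_neg, sub_neg_eq_add, sub_neg_eq_add] at k₁ k₂
    rw [sub_zero] at hp₁ hq₁ hp₂ hq₂
    refine ⟨p₁ + z, q₁ + z, p₂ + z, q₂ + z, by rwa [add_sub_cancel_right], by rwa [add_sub_cancel_right],
      by rwa [add_sub_cancel_right], by rwa [add_sub_cancel_right], k₁, k₂, fun h ↦ hsep ?_⟩
    have k := NeckCoarse.pathIn_open_shift z z h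
    rw [sub_self, add_sub_cancel_right, add_sub_cancel_right] at k
    exact k

/-- **Translation invariance of the probability.** -/
theorem real_tFourArmTwoClusters_eq_zero (z : Site 2) (r R : ℕ) :
    (triSitePercolation half).real (TFourArmTwoClusters z r R) = (triSitePercolation half).real (TFourArmTwoClusters 0 r R) := by
  rw [tFourArmTwoClusters_eq_preimage z r R]
  exact sitePercolation_real_preimage_relabel _ _ _

/-- **The cluster-form four-arm probability is at most the tree's critical four-arm probability** (`1 ≤ r`, `r + 2 ≤ R`). -/
theorem real_tFourArmTwoClusters_le_critFourArmProb (z : Site 2) {r R : ℕ} (hr : 1 ≤ r) (hrR : r + 2 ≤ R) :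
    (triSitePercolation half).real (TFourArmTwoClusters z r R) ≤ critFourArmProb r R := by
  rw [real_tFourArmTwoClusters_eq_zero]
  exact measureReal_mono (tFourArmTwoClusters_zero_subset_armEvent hr hrR) (measure_ne_top _ _)

/-! ### (I4T) from a two-radius bound on the tree's four-arm probability -/

/-- **(I4T) from a two-radius four-arm bound with exponent `> 1` on `critFourArmProb`.**  The two radii with `R < r + 2`
are absorbed into the constant (`(r/R)^{1+ε} ≥ 3^{-(1+ε)}` there). -/
theorem fourArmTwoClustersBoundT_of_critFourArmProb_le : (∃ ε C : ℝ, 0 < ε ∧ ∀ r R : ℕ, 1 ≤ r → r ≤ R → critFourArmProb r R ≤ C * ((r : ℝ) / R) ^ (1 + ε)) → FourArmTwoClustersBoundT := by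
  rintro ⟨ε, C, hε, hC⟩
  refine ⟨ε, max C (3 ^ (1 + ε)), hε, fun z r R hr hrR ↦ ?_⟩
  have hr0 : (0 : ℝ) < r := by exact_mod_cast hr
  have hR0 : (0 : ℝ) < R := by exact_mod_cast (hr.trans hrR)
  have hq0 : 0 < (r : ℝ) / R := div_pos hr0 hR0
  have hpow0 : 0 < ((r : ℝ) / R) ^ (1 + ε) := Real.rpow_pos_of_pos hq0 _
  by_cases h2 : r + 2 ≤ R
  · calc (triSitePercolation half).real (TFourArmTwoClusters z r R)
        ≤ critFourArmProb r R := real_tFourArmTwoClusters_le_critFourArmProb z hr h2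
      _ ≤ C * ((r : ℝ) / R) ^ (1 + ε) := hC r R hr hrR
      _ ≤ max C (3 ^ (1 + ε)) * ((r : ℝ) / R) ^ (1 + ε) :=
          mul_le_mul_of_nonneg_right (le_max_left _ _) hpow0.le
  · -- `R ≤ r + 1`: the bound is at least `1`
    have hRr : (R : ℝ) ≤ 3 * r := by
      have : R ≤ 3 * r := by omega
      exact_mod_cast this
    have hq : (1 : ℝ) / 3 ≤ (r : ℝ) / R := by
      rw [div_le_div_iff₀ (by norm_num) hR0]; linarith
    calc (triSitePercolation half).real (TFourArmTwoClusters z r R) ≤ 1 := measureReal_le_one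
      _ = 3 ^ (1 + ε) * ((1 : ℝ) / 3) ^ (1 + ε) := by
          rw [← Real.mul_rpow (by norm_num) (by norm_num)]; norm_num
      _ ≤ 3 ^ (1 + ε) * ((r : ℝ) / R) ^ (1 + ε) :=
          mul_le_mul_of_nonneg_left (Real.rpow_le_rpow (by norm_num) hq (by linarith)) (by positivity)
      _ ≤ max C (3 ^ (1 + ε)) * ((r : ℝ) / R) ^ (1 + ε) :=
          mul_le_mul_of_nonneg_right (le_max_right _ _) hpow0.le

end Summit.CriticalPhenomena.CardyFormulaZ2.Cruxes.NestingRigidity.PinchResampling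

end
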